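import Summits.ValiantsHypothesis.ValiantsHypothesis.Theorems.LacunarySymmetroidMatrixDescartesOsculationLawGPLogHessianMul
import Summits.ValiantsHypothesis.ValiantsHypothesis.Theorems.LacunarySymmetroidMatrixDescartesOsculationLawStubRankOne
import Summits.ValiantsHypothesis.ValiantsHypothesis.Theorems.LacunarySymmetroidMatrixDescartesOsculationLawCuspNonMonicCount

/-!
# ValiantsHypothesis / LacunarySymmetroid — crux `MatrixDescartes` (stmt-ValiantsHypothesis-18050, V1),
# line `Cruxes/MatrixDescartes/Lines/osculation_law.lean` («osculation-law»): BLOCK-SUM (DECOUPLING) LAW —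
# a block sum aligned with the projector: the bottom summand is invisible to the osculation count

Rung O5 of the line (desk R2664 / director R260 «block-sum additivity»; seat val-sym-trop-p4 (g16), 2026-08-28;
`--supports stmt-ValiantsHypothesis-18050 --as helper`).  In the line's frame the inserted semidefinite letter is
`b · (I_r ⊕ 0)` on `Fin r ⊕ Fin s`; a block pencil ALIGNED with this projector is `S l = fromBlocks (A l) 0 0 (D l)` — the top
summand `A : Fin K → Matrix (Fin r) (Fin r) ℝ` meets the letter, the bottom summand `D : Fin K → Matrix (Fin s) (Fin s) ℝ` does not.
Then `Φ(t,b) = det(A(t) + b·1) · det D(t)`; by the product rule for the bordered log-Hessian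
(`OsculationGeneric.eval_logHessian_mul_of_eval_eq_zero`) and because the log-Hessian of a `b`-free factor vanishes
identically, the OSCULATION SET DECOUPLES EXACTLY:

  `osc(A ⊕ D) = osc(A ⊕ 0₀) ∪ {(t,b) : t > 0, b > 0, det D(t) = 0}`   (`osculationSet_fromBlocks`, no hypothesis at all),

where `A ⊕ 0₀` is the top summand at the splitting `(r, 0)`.  Hence (`osculationSet_fromBlocks_finite`) a finite osculation
set forces `det D` to have no positive zero (a zero is a whole vertical ray) and then `osc(A ⊕ D) = osc(A ⊕ 0₀)`: the bottom
summand counts ZERO.  The RUNG (`osculationLawAt_decoupled`) is the line's `OsculationLawAt m K B` body with ONE hypothesis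
inserted — the letters are block-diagonal for the projector's splitting, `(S l).toBlocks₁₂ = 0 ∧ (S l).toBlocks₂₁ = 0` — derived
from the law's body at the formats `r ≤ m` (their top splittings `(r,0)` suffice).  The line's vocabulary (`blockProj`,
`insertionPoly`, `euler`, `logHessian`, `osculationSet`, `lowerDet`) is UNFOLDED verbatim (a Theorems file cannot import the
Cruxes line file), exactly as in `OsculationUniformRung.osculationLawAt_all`.

HONEST FRAMING.  The ALIGNED half of block-sum additivity (bottom summand invisible); the STRADDLING half (both summands meeting
the projector: `osc(S₁ ⊕ S₂) ⊆ osc S₁ ∪ osc S₂ ∪ {sheet crossings}`, which needs a `finSumFinEquiv` re-indexing of the frame) is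
NOT claimed here.  A bookkeeping RUNG, not the LAW: `stub_osculationLaw` (`OsculationLaw`), the crux `MatrixDescartes`
(stmt-18050), Conjecture B and `VP ≠ VNP` stay OPEN / NOT proved.  No definitions, no named facts.
-/

set_option linter.dupNamespace false
set_option autoImplicit false

noncomputable section

namespace Summit.ValiantsHypothesis.ValiantsHypothesis.Theorems.LacunarySymmetroidMatrixDescartes

open Polynomial Matrix Finset
open scoped BigOperators

namespace OsculationBlockSum

/-! ### The bordered log-Hessian of a product and of a `b`-free polynomial -/

/-- The bordered log-Hessian of a polynomial not involving `X₁` vanishes identically. [folklore] -/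
theorem logHessian_eq_zero_of_pderiv_one (B : MvPolynomial (Fin 2) ℝ) (hB : MvPolynomial.pderiv 1 B = 0) :
    MvPolynomial.X 0 * MvPolynomial.pderiv 0 (MvPolynomial.X 0 * MvPolynomial.pderiv 0 B) * (MvPolynomial.X 1 * MvPolynomial.pderiv 1 B) ^ 2
      - 2 * (MvPolynomial.X 0 * MvPolynomial.pderiv 0 (MvPolynomial.X 1 * MvPolynomial.pderiv 1 B)) * (MvPolynomial.X 0 * MvPolynomial.pderiv 0 B) * (MvPolynomial.X 1 * MvPolynomial.pderiv 1 B)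
      + MvPolynomial.X 1 * MvPolynomial.pderiv 1 (MvPolynomial.X 1 * MvPolynomial.pderiv 1 B) * (MvPolynomial.X 0 * MvPolynomial.pderiv 0 B) ^ 2 = 0 := by
  rw [hB]
  simp

/-- **Osculation of a product with a `b`-free factor** (pointwise): for `Φ = T · B` with `∂₁ B = 0`, a point `p` satisfies
`Φ(p) = 0 ∧ H(Φ)(p) = 0` iff `B(p) = 0`, or `T(p) = 0 ∧ H(T)(p) = 0`. [this seat's lemma] -/
theorem osc_mul_iff (T B : MvPolynomial (Fin 2) ℝ) (hB : MvPolynomial.pderiv 1 B = 0) (p : Fin 2 → ℝ) :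
    (MvPolynomial.eval p (T * B) = 0 ∧ MvPolynomial.eval p
      (MvPolynomial.X 0 * MvPolynomial.pderiv 0 (MvPolynomial.X 0 * MvPolynomial.pderiv 0 (T * B)) * (MvPolynomial.X 1 * MvPolynomial.pderiv 1 (T * B)) ^ 2
      - 2 * (MvPolynomial.X 0 * MvPolynomial.pderiv 0 (MvPolynomial.X 1 * MvPolynomial.pderiv 1 (T * B))) * (MvPolynomial.X 0 * MvPolynomial.pderiv 0 (T * B)) * (MvPolynomial.X 1 * MvPolynomial.pderiv 1 (T * B))
      + MvPolynomial.X 1 * MvPolynomial.pderiv 1 (MvPolynomial.X 1 * MvPolynomial.pderiv 1 (T * B)) * (MvPolynomial.X 0 * MvPolynomial.pderiv 0 (T * B)) ^ 2) = 0) ↔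
    (MvPolynomial.eval p B = 0 ∨ (MvPolynomial.eval p T = 0 ∧ MvPolynomial.eval p
      (MvPolynomial.X 0 * MvPolynomial.pderiv 0 (MvPolynomial.X 0 * MvPolynomial.pderiv 0 T) * (MvPolynomial.X 1 * MvPolynomial.pderiv 1 T) ^ 2
      - 2 * (MvPolynomial.X 0 * MvPolynomial.pderiv 0 (MvPolynomial.X 1 * MvPolynomial.pderiv 1 T)) * (MvPolynomial.X 0 * MvPolynomial.pderiv 0 T) * (MvPolynomial.X 1 * MvPolynomial.pderiv 1 T)
      + MvPolynomial.X 1 * MvPolynomial.pderiv 1 (MvPolynomial.X 1 * MvPolynomial.pderiv 1 T) * (MvPolynomial.X 0 * MvPolynomial.pderiv 0 T) ^ 2) = 0)) := by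
  have hHB := logHessian_eq_zero_of_pderiv_one B hB
  by_cases hBp : MvPolynomial.eval p B = 0
  · -- on the zero set of the `b`-free factor both conditions hold
    have h1 : MvPolynomial.eval p (T * B) = 0 := by rw [map_mul, hBp, mul_zero]
    have h2 := OsculationGeneric.eval_logHessian_mul_of_eval_eq_zero B T p hBp
    rw [mul_comm B T] at h2
    rw [hHB, map_zero, mul_zero] at h2
    simp only [hBp, true_or, iff_true]
    exact ⟨h1, h2⟩
  · constructor
    · rintro ⟨hΦ, hH⟩
      right
      have hT : MvPolynomial.eval p T = 0 := by
        rw [map_mul] at hΦ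
        rcases mul_eq_zero.mp hΦ with h | h
        · exact h
        · exact absurd h hBp
      refine ⟨hT, ?_⟩
      have h2 := OsculationGeneric.eval_logHessian_mul_of_eval_eq_zero T B p hT
      rw [h2] at hH
      rcases mul_eq_zero.mp hH with h | h
      · exact absurd (pow_eq_zero_iff (by norm_num) |>.mp h) hBp
      · exact h
    · rintro (h | ⟨hT, hH⟩)
      · exact absurd h hBp
      · refine ⟨by rw [map_mul, hT, zero_mul], ?_⟩
        rw [OsculationGeneric.eval_logHessian_mul_of_eval_eq_zero T B p hT, hH, mul_zero]

/-! ### The insertion polynomial of an aligned block sum factors -/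

variable {r s K : ℕ}

/-- The pencil-plus-letter matrix of an aligned block sum is block diagonal: top block `Σ X₀^{d l} A_l + X₁·1`, bottom block
`Σ X₀^{d l} D_l`. [folklore] -/
theorem pencil_fromBlocks (d : Fin K → ℕ) (A : Fin K → Matrix (Fin r) (Fin r) ℝ) (D : Fin K → Matrix (Fin s) (Fin s) ℝ) :
    (∑ l, (MvPolynomial.X (0 : Fin 2) : MvPolynomial (Fin 2) ℝ) ^ d l •
          (Matrix.fromBlocks (A l) 0 0 (D l)).map (MvPolynomial.C : ℝ →+* MvPolynomial (Fin 2) ℝ)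
        + (MvPolynomial.X (1 : Fin 2) : MvPolynomial (Fin 2) ℝ) •
          (Matrix.fromBlocks 1 0 0 0 : Matrix (Fin r ⊕ Fin s) (Fin r ⊕ Fin s) ℝ).map
                (MvPolynomial.C : ℝ →+* MvPolynomial (Fin 2) ℝ))
      = Matrix.fromBlocks (∑ l, (MvPolynomial.X (0 : Fin 2) : MvPolynomial (Fin 2) ℝ) ^ d l • (A l).map (MvPolynomial.C : ℝ →+* MvPolynomial (Fin 2) ℝ) + (MvPolynomial.X (1 : Fin 2) : MvPolynomial (Fin 2) ℝ) • (1 : Matrix (Fin r) (Fin r) (MvPolynomial (Fin 2) ℝ))) 0 0 (∑ l, (MvPolynomial.X (0 : Fin 2) : MvPolynomial (Fin 2) ℝ) ^ d l • (D l).map (MvPolynomial.C : ℝ →+* MvPolynomial (Fin 2) ℝ)) := by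
  refine Matrix.ext fun i j => ?_
  rcases i with i | i <;> rcases j with j | j
  · by_cases hij : i = j <;>
      simp only [Matrix.add_apply, Matrix.sum_apply, Matrix.smul_apply, Matrix.map_apply, Matrix.fromBlocks_apply₁₁,
        Matrix.one_apply, hij, if_true, if_false, map_one, map_zero, smul_eq_mul, mul_one, mul_zero]
  · simp only [Matrix.add_apply, Matrix.sum_apply, Matrix.smul_apply, Matrix.map_apply, Matrix.fromBlocks_apply₁₂,
      Matrix.zero_apply, map_zero, smul_eq_mul, mul_zero, Finset.sum_const_zero, add_zero]
  · simp only [Matrix.add_apply, Matrix.sum_apply, Matrix.smul_apply, Matrix.map_apply, Matrix.fromBlocks_apply₂₁,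
      Matrix.zero_apply, map_zero, smul_eq_mul, mul_zero, Finset.sum_const_zero, add_zero]
  · simp only [Matrix.add_apply, Matrix.sum_apply, Matrix.smul_apply, Matrix.map_apply, Matrix.fromBlocks_apply₂₂,
      Matrix.zero_apply, map_zero, smul_eq_mul, mul_zero, add_zero]

/-- **Factorisation**: `Φ(A ⊕ D) = det(Σ X₀^{d l} A_l + X₁·1) · det(Σ X₀^{d l} D_l)`. [folklore] -/
theorem insertionPoly_fromBlocks (d : Fin K → ℕ) (A : Fin K → Matrix (Fin r) (Fin r) ℝ)
    (D : Fin K → Matrix (Fin s) (Fin s) ℝ) :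
    (∑ l, (MvPolynomial.X (0 : Fin 2) : MvPolynomial (Fin 2) ℝ) ^ d l •
              (Matrix.fromBlocks (A l) 0 0 (D l)).map (MvPolynomial.C : ℝ →+* MvPolynomial (Fin 2) ℝ)
            + (MvPolynomial.X (1 : Fin 2) : MvPolynomial (Fin 2) ℝ) •
              (Matrix.fromBlocks 1 0 0 0 : Matrix (Fin r ⊕ Fin s) (Fin r ⊕ Fin s) ℝ).map
                (MvPolynomial.C : ℝ →+* MvPolynomial (Fin 2) ℝ)).det
      = (∑ l, (MvPolynomial.X (0 : Fin 2) : MvPolynomial (Fin 2) ℝ) ^ d l • (A l).map (MvPolynomial.C : ℝ →+* MvPolynomial (Fin 2) ℝ) + (MvPolynomial.X (1 : Fin 2) : MvPolynomial (Fin 2) ℝ) • (1 : Matrix (Fin r) (Fin r) (MvPolynomial (Fin 2) ℝ))).det * (∑ l, (MvPolynomial.X (0 : Fin 2) : MvPolynomial (Fin 2) ℝ) ^ d l • (D l).map (MvPolynomial.C : ℝ →+* MvPolynomial (Fin 2) ℝ)).det := by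
  rw [pencil_fromBlocks, Matrix.det_fromBlocks_zero₂₁]

/-- The bottom determinant is the embedded one-variable determinant `ι(det Σ X^{d l} D_l)`, `ι : X ↦ X₀`. [folklore] -/
theorem bottom_det_eq_aeval (d : Fin K → ℕ) (D : Fin K → Matrix (Fin s) (Fin s) ℝ) :
    (∑ l, (MvPolynomial.X (0 : Fin 2) : MvPolynomial (Fin 2) ℝ) ^ d l • (D l).map (MvPolynomial.C : ℝ →+* MvPolynomial (Fin 2) ℝ)).det
      = Polynomial.aeval (MvPolynomial.X 0 : MvPolynomial (Fin 2) ℝ) (∑ l, (Polynomial.X : Polynomial ℝ) ^ d l • (D l).map (Polynomial.C : ℝ →+* Polynomial ℝ)).det := by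
  rw [AlgHom.map_det, AlgHom.mapMatrix_apply, OsculationRankOne.map_aevalX0_pencil]

/-- At the top splitting `(r, 0)` the bottom determinant is `1`: `Φ(A ⊕ 0₀) = det(Σ X₀^{d l} A_l + X₁·1)`. [folklore] -/
theorem insertionPoly_top (d : Fin K → ℕ) (A : Fin K → Matrix (Fin r) (Fin r) ℝ) :
    (∑ l, (MvPolynomial.X (0 : Fin 2) : MvPolynomial (Fin 2) ℝ) ^ d l •
              (Matrix.fromBlocks (A l) 0 0 (0 : Matrix (Fin 0) (Fin 0) ℝ)).map (MvPolynomial.C : ℝ →+* MvPolynomial (Fin 2) ℝ)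
            + (MvPolynomial.X (1 : Fin 2) : MvPolynomial (Fin 2) ℝ) •
              (Matrix.fromBlocks 1 0 0 0 : Matrix (Fin r ⊕ Fin 0) (Fin r ⊕ Fin 0) ℝ).map
                (MvPolynomial.C : ℝ →+* MvPolynomial (Fin 2) ℝ)).det
      = (∑ l, (MvPolynomial.X (0 : Fin 2) : MvPolynomial (Fin 2) ℝ) ^ d l • (A l).map (MvPolynomial.C : ℝ →+* MvPolynomial (Fin 2) ℝ) + (MvPolynomial.X (1 : Fin 2) : MvPolynomial (Fin 2) ℝ) • (1 : Matrix (Fin r) (Fin r) (MvPolynomial (Fin 2) ℝ))).det := by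
  rw [insertionPoly_fromBlocks]
  convert mul_one _ using 2
  exact Matrix.det_isEmpty

/-! ### The decoupling identity -/

/-- **EXACT DECOUPLING OF THE OSCULATION SET** (no hypothesis): for a block pencil aligned with the projector,
`osc(A ⊕ D) = osc(A ⊕ 0₀) ∪ {(t, b) : t > 0, b > 0, det(Σ t^{d l} D_l) = 0}` — the osculation set of the top summand at the
splitting `(r,0)` together with the vertical rays over the positive zeros of the bottom determinant (`lowerDet`).
[this seat's theorem; O5 «block-sum additivity», aligned half] -/
theorem osculationSet_fromBlocks (d : Fin K → ℕ) (A : Fin K → Matrix (Fin r) (Fin r) ℝ)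
    (D : Fin K → Matrix (Fin s) (Fin s) ℝ) :
    {p : Fin 2 → ℝ | 0 < p 0 ∧ 0 < p 1 ∧ MvPolynomial.eval p (∑ l, (MvPolynomial.X (0 : Fin 2) : MvPolynomial (Fin 2) ℝ) ^ d l •
              (Matrix.fromBlocks (A l) 0 0 (D l)).map (MvPolynomial.C : ℝ →+* MvPolynomial (Fin 2) ℝ)
            + (MvPolynomial.X (1 : Fin 2) : MvPolynomial (Fin 2) ℝ) •
              (Matrix.fromBlocks 1 0 0 0 : Matrix (Fin r ⊕ Fin s) (Fin r ⊕ Fin s) ℝ).map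
                (MvPolynomial.C : ℝ →+* MvPolynomial (Fin 2) ℝ)).det = 0 ∧
      MvPolynomial.eval p
        (MvPolynomial.X 0 * MvPolynomial.pderiv 0 (MvPolynomial.X 0 * MvPolynomial.pderiv 0 ((∑ l, (MvPolynomial.X (0 : Fin 2) : MvPolynomial (Fin 2) ℝ) ^ d l •
              (Matrix.fromBlocks (A l) 0 0 (D l)).map (MvPolynomial.C : ℝ →+* MvPolynomial (Fin 2) ℝ)
            + (MvPolynomial.X (1 : Fin 2) : MvPolynomial (Fin 2) ℝ) •
              (Matrix.fromBlocks 1 0 0 0 : Matrix (Fin r ⊕ Fin s) (Fin r ⊕ Fin s) ℝ).map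
                (MvPolynomial.C : ℝ →+* MvPolynomial (Fin 2) ℝ)).det))
            * (MvPolynomial.X 1 * MvPolynomial.pderiv 1 ((∑ l, (MvPolynomial.X (0 : Fin 2) : MvPolynomial (Fin 2) ℝ) ^ d l •
              (Matrix.fromBlocks (A l) 0 0 (D l)).map (MvPolynomial.C : ℝ →+* MvPolynomial (Fin 2) ℝ)
            + (MvPolynomial.X (1 : Fin 2) : MvPolynomial (Fin 2) ℝ) •
              (Matrix.fromBlocks 1 0 0 0 : Matrix (Fin r ⊕ Fin s) (Fin r ⊕ Fin s) ℝ).map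
                (MvPolynomial.C : ℝ →+* MvPolynomial (Fin 2) ℝ)).det)) ^ 2
          - 2 * (MvPolynomial.X 0 * MvPolynomial.pderiv 0 (MvPolynomial.X 1 * MvPolynomial.pderiv 1 ((∑ l, (MvPolynomial.X (0 : Fin 2) : MvPolynomial (Fin 2) ℝ) ^ d l •
              (Matrix.fromBlocks (A l) 0 0 (D l)).map (MvPolynomial.C : ℝ →+* MvPolynomial (Fin 2) ℝ)
            + (MvPolynomial.X (1 : Fin 2) : MvPolynomial (Fin 2) ℝ) •
              (Matrix.fromBlocks 1 0 0 0 : Matrix (Fin r ⊕ Fin s) (Fin r ⊕ Fin s) ℝ).map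
                (MvPolynomial.C : ℝ →+* MvPolynomial (Fin 2) ℝ)).det)))
            * (MvPolynomial.X 0 * MvPolynomial.pderiv 0 ((∑ l, (MvPolynomial.X (0 : Fin 2) : MvPolynomial (Fin 2) ℝ) ^ d l •
              (Matrix.fromBlocks (A l) 0 0 (D l)).map (MvPolynomial.C : ℝ →+* MvPolynomial (Fin 2) ℝ)
            + (MvPolynomial.X (1 : Fin 2) : MvPolynomial (Fin 2) ℝ) •
              (Matrix.fromBlocks 1 0 0 0 : Matrix (Fin r ⊕ Fin s) (Fin r ⊕ Fin s) ℝ).map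
                (MvPolynomial.C : ℝ →+* MvPolynomial (Fin 2) ℝ)).det)) * (MvPolynomial.X 1 * MvPolynomial.pderiv 1 ((∑ l, (MvPolynomial.X (0 : Fin 2) : MvPolynomial (Fin 2) ℝ) ^ d l •
              (Matrix.fromBlocks (A l) 0 0 (D l)).map (MvPolynomial.C : ℝ →+* MvPolynomial (Fin 2) ℝ)
            + (MvPolynomial.X (1 : Fin 2) : MvPolynomial (Fin 2) ℝ) •
              (Matrix.fromBlocks 1 0 0 0 : Matrix (Fin r ⊕ Fin s) (Fin r ⊕ Fin s) ℝ).map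
                (MvPolynomial.C : ℝ →+* MvPolynomial (Fin 2) ℝ)).det))
          + MvPolynomial.X 1 * MvPolynomial.pderiv 1 (MvPolynomial.X 1 * MvPolynomial.pderiv 1 ((∑ l, (MvPolynomial.X (0 : Fin 2) : MvPolynomial (Fin 2) ℝ) ^ d l •
              (Matrix.fromBlocks (A l) 0 0 (D l)).map (MvPolynomial.C : ℝ →+* MvPolynomial (Fin 2) ℝ)
            + (MvPolynomial.X (1 : Fin 2) : MvPolynomial (Fin 2) ℝ) •
              (Matrix.fromBlocks 1 0 0 0 : Matrix (Fin r ⊕ Fin s) (Fin r ⊕ Fin s) ℝ).map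
                (MvPolynomial.C : ℝ →+* MvPolynomial (Fin 2) ℝ)).det))
            * (MvPolynomial.X 0 * MvPolynomial.pderiv 0 ((∑ l, (MvPolynomial.X (0 : Fin 2) : MvPolynomial (Fin 2) ℝ) ^ d l •
              (Matrix.fromBlocks (A l) 0 0 (D l)).map (MvPolynomial.C : ℝ →+* MvPolynomial (Fin 2) ℝ)
            + (MvPolynomial.X (1 : Fin 2) : MvPolynomial (Fin 2) ℝ) •
              (Matrix.fromBlocks 1 0 0 0 : Matrix (Fin r ⊕ Fin s) (Fin r ⊕ Fin s) ℝ).map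
                (MvPolynomial.C : ℝ →+* MvPolynomial (Fin 2) ℝ)).det)) ^ 2) = 0}
      = {p : Fin 2 → ℝ | 0 < p 0 ∧ 0 < p 1 ∧ MvPolynomial.eval p (∑ l, (MvPolynomial.X (0 : Fin 2) : MvPolynomial (Fin 2) ℝ) ^ d l •
              (Matrix.fromBlocks (A l) 0 0 (0 : Matrix (Fin 0) (Fin 0) ℝ)).map (MvPolynomial.C : ℝ →+* MvPolynomial (Fin 2) ℝ)
            + (MvPolynomial.X (1 : Fin 2) : MvPolynomial (Fin 2) ℝ) •
              (Matrix.fromBlocks 1 0 0 0 : Matrix (Fin r ⊕ Fin 0) (Fin r ⊕ Fin 0) ℝ).map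
                (MvPolynomial.C : ℝ →+* MvPolynomial (Fin 2) ℝ)).det = 0 ∧
      MvPolynomial.eval p
        (MvPolynomial.X 0 * MvPolynomial.pderiv 0 (MvPolynomial.X 0 * MvPolynomial.pderiv 0 ((∑ l, (MvPolynomial.X (0 : Fin 2) : MvPolynomial (Fin 2) ℝ) ^ d l •
              (Matrix.fromBlocks (A l) 0 0 (0 : Matrix (Fin 0) (Fin 0) ℝ)).map (MvPolynomial.C : ℝ →+* MvPolynomial (Fin 2) ℝ)
            + (MvPolynomial.X (1 : Fin 2) : MvPolynomial (Fin 2) ℝ) •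
              (Matrix.fromBlocks 1 0 0 0 : Matrix (Fin r ⊕ Fin 0) (Fin r ⊕ Fin 0) ℝ).map
                (MvPolynomial.C : ℝ →+* MvPolynomial (Fin 2) ℝ)).det))
            * (MvPolynomial.X 1 * MvPolynomial.pderiv 1 ((∑ l, (MvPolynomial.X (0 : Fin 2) : MvPolynomial (Fin 2) ℝ) ^ d l •
              (Matrix.fromBlocks (A l) 0 0 (0 : Matrix (Fin 0) (Fin 0) ℝ)).map (MvPolynomial.C : ℝ →+* MvPolynomial (Fin 2) ℝ)
            + (MvPolynomial.X (1 : Fin 2) : MvPolynomial (Fin 2) ℝ) •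
              (Matrix.fromBlocks 1 0 0 0 : Matrix (Fin r ⊕ Fin 0) (Fin r ⊕ Fin 0) ℝ).map
                (MvPolynomial.C : ℝ →+* MvPolynomial (Fin 2) ℝ)).det)) ^ 2
          - 2 * (MvPolynomial.X 0 * MvPolynomial.pderiv 0 (MvPolynomial.X 1 * MvPolynomial.pderiv 1 ((∑ l, (MvPolynomial.X (0 : Fin 2) : MvPolynomial (Fin 2) ℝ) ^ d l •
              (Matrix.fromBlocks (A l) 0 0 (0 : Matrix (Fin 0) (Fin 0) ℝ)).map (MvPolynomial.C : ℝ →+* MvPolynomial (Fin 2) ℝ)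
            + (MvPolynomial.X (1 : Fin 2) : MvPolynomial (Fin 2) ℝ) •
              (Matrix.fromBlocks 1 0 0 0 : Matrix (Fin r ⊕ Fin 0) (Fin r ⊕ Fin 0) ℝ).map
                (MvPolynomial.C : ℝ →+* MvPolynomial (Fin 2) ℝ)).det)))
            * (MvPolynomial.X 0 * MvPolynomial.pderiv 0 ((∑ l, (MvPolynomial.X (0 : Fin 2) : MvPolynomial (Fin 2) ℝ) ^ d l •
              (Matrix.fromBlocks (A l) 0 0 (0 : Matrix (Fin 0) (Fin 0) ℝ)).map (MvPolynomial.C : ℝ →+* MvPolynomial (Fin 2) ℝ)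
            + (MvPolynomial.X (1 : Fin 2) : MvPolynomial (Fin 2) ℝ) •
              (Matrix.fromBlocks 1 0 0 0 : Matrix (Fin r ⊕ Fin 0) (Fin r ⊕ Fin 0) ℝ).map
                (MvPolynomial.C : ℝ →+* MvPolynomial (Fin 2) ℝ)).det)) * (MvPolynomial.X 1 * MvPolynomial.pderiv 1 ((∑ l, (MvPolynomial.X (0 : Fin 2) : MvPolynomial (Fin 2) ℝ) ^ d l •
              (Matrix.fromBlocks (A l) 0 0 (0 : Matrix (Fin 0) (Fin 0) ℝ)).map (MvPolynomial.C : ℝ →+* MvPolynomial (Fin 2) ℝ)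
            + (MvPolynomial.X (1 : Fin 2) : MvPolynomial (Fin 2) ℝ) •
              (Matrix.fromBlocks 1 0 0 0 : Matrix (Fin r ⊕ Fin 0) (Fin r ⊕ Fin 0) ℝ).map
                (MvPolynomial.C : ℝ →+* MvPolynomial (Fin 2) ℝ)).det))
          + MvPolynomial.X 1 * MvPolynomial.pderiv 1 (MvPolynomial.X 1 * MvPolynomial.pderiv 1 ((∑ l, (MvPolynomial.X (0 : Fin 2) : MvPolynomial (Fin 2) ℝ) ^ d l •
              (Matrix.fromBlocks (A l) 0 0 (0 : Matrix (Fin 0) (Fin 0) ℝ)).map (MvPolynomial.C : ℝ →+* MvPolynomial (Fin 2) ℝ)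
            + (MvPolynomial.X (1 : Fin 2) : MvPolynomial (Fin 2) ℝ) •
              (Matrix.fromBlocks 1 0 0 0 : Matrix (Fin r ⊕ Fin 0) (Fin r ⊕ Fin 0) ℝ).map
                (MvPolynomial.C : ℝ →+* MvPolynomial (Fin 2) ℝ)).det))
            * (MvPolynomial.X 0 * MvPolynomial.pderiv 0 ((∑ l, (MvPolynomial.X (0 : Fin 2) : MvPolynomial (Fin 2) ℝ) ^ d l •
              (Matrix.fromBlocks (A l) 0 0 (0 : Matrix (Fin 0) (Fin 0) ℝ)).map (MvPolynomial.C : ℝ →+* MvPolynomial (Fin 2) ℝ)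
            + (MvPolynomial.X (1 : Fin 2) : MvPolynomial (Fin 2) ℝ) •
              (Matrix.fromBlocks 1 0 0 0 : Matrix (Fin r ⊕ Fin 0) (Fin r ⊕ Fin 0) ℝ).map
                (MvPolynomial.C : ℝ →+* MvPolynomial (Fin 2) ℝ)).det)) ^ 2) = 0}
        ∪ {p : Fin 2 → ℝ | 0 < p 0 ∧ 0 < p 1 ∧ Polynomial.eval (p 0) (∑ l, (Polynomial.X : Polynomial ℝ) ^ d l • (D l).map (Polynomial.C : ℝ →+* Polynomial ℝ)).det = 0} := by
  have hB : MvPolynomial.pderiv 1 (∑ l, (MvPolynomial.X (0 : Fin 2) : MvPolynomial (Fin 2) ℝ) ^ d l • (D l).map (MvPolynomial.C : ℝ →+* MvPolynomial (Fin 2) ℝ)).det = 0 := by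
    rw [bottom_det_eq_aeval]; exact OsculationRankOne.pderiv_one_aevalX0 _
  have hBev : ∀ p : Fin 2 → ℝ, MvPolynomial.eval p (∑ l, (MvPolynomial.X (0 : Fin 2) : MvPolynomial (Fin 2) ℝ) ^ d l • (D l).map (MvPolynomial.C : ℝ →+* MvPolynomial (Fin 2) ℝ)).det
      = Polynomial.eval (p 0) (∑ l, (Polynomial.X : Polynomial ℝ) ^ d l • (D l).map (Polynomial.C : ℝ →+* Polynomial ℝ)).det := by
    intro p; rw [bottom_det_eq_aeval, OsculationRankOne.eval_aevalX0]
  ext p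
  simp only [Set.mem_setOf_eq, Set.mem_union]
  rw [insertionPoly_fromBlocks, insertionPoly_top, osc_mul_iff _ _ hB p, hBev p]
  tauto

end OsculationBlockSum

end Summit.ValiantsHypothesis.ValiantsHypothesis.Theorems.LacunarySymmetroidMatrixDescartes
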